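import Summits.ValiantsHypothesis.ValiantsHypothesis.Theorems.KPlusLogSqLawTropicalBEpochLaw

/-!
# Route «KPlusLogSqLaw», crux `TropicalB` (stmt-ValiantsHypothesis-19771) — THE EPOCH LAW IS `K`-FREE: in the valuation-separated corner
# every dominant chain has at most `2m + 5` terms

HONEST FRAMING.  Sequel of `…TropicalBEpochLaw` (this seat, p574666; `--supports … --as helper`) toward the registered stubs of
`Cruxes/TropicalB/Lines/birth.lean` (crux `Summit.ValiantsHypothesis.ValiantsHypothesis.Theses.KPlusLogSqLaw.TropicalB`, item
stmt-ValiantsHypothesis-19771, route KPlusLogSqLaw, DRAFT; cell `pub-symmetroid`, seat val-sym-trop-p1 g12, 2026-08-27).  A SECTOR law far from the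
window; nothing here bounds `TropicalB` for general designs or bears on `WeakLifting`, the doors, `MatrixDescartes` (stmt-ValiantsHypothesis-18050)
or VP ≠ VNP.

THE SHARPENING.  Part 1 proved the desk's target `EpochLaw` with the bound `2(K+1)(m+1) + 1` (≤ `K + 1` frozen sets per sign of the slope, ≤ `m + 1`
terms per frozen set).  But the slopes of `TropRootLawAt` are INTEGERS: at every slope `θ ≠ 0` one has `|θ| ≥ 1`, and under the separation
`d l < d l' → ρ·d l < d l'` with `4mR < ρ` EVERY class lying above some positive value is frozen at once (`|θ|·d l ≥ d l > ρ·d l' ≥ ρ > 4mR`,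
`frozen_of_pos_lt`).  So per sign of the slope only TWO frozen sets occur — «everything above the least positive value `D₁`» and «every positive
value» — and the chain indices of one sign number at most `(m + 1) + 1`:
* `sum_d_eq_above_add_of_minPos` — if `D₁` is the least positive value, `Σᵢ d (r i) = Σ_{D₁ < d (r i)} d (r i) + D₁ · #{i : d (r i) = D₁}`;
* `card_sign_le_sharp` — the indices with `0 < σ·θ_k` (`σ = ±1`) number `≤ m + 2`: those at which `D₁` is NOT frozen agree pairwise on every
  value count above `D₁` (`countVal_eq_of_frozen`), so their slopes are `A + D₁·#{d = D₁}` with one `A` and pairwise distinct — at most `m + 1` of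
  them; those at which `D₁` IS frozen agree on every positive value count, hence have equal slopes — at most one;
* `chain_le_sharp` — **THE `K`-FREE EPOCH LAW**: `|v| ≤ R`, values `ρ`-separated, `2m ≤ ρ`, `4mR < ρ` ⇒ every chain of unique optima at strictly
  increasing integer slopes with distinct consecutive terms has `n + 1 ≤ 2m + 5` (`m + 2` per sign, one at slope `0`);
* `epochLaw_sharp` — the typed hypotheses of `Epoch.epochLaw` (`ρ = 16(m+1)²(R+1)`, `|ε| ≤ 1`, alternating signs) ⇒ `n + 1 ≤ 2m + 5`.

READING (located).  In this corner the `K` classes are invisible at integer slopes: whatever `K` is, at most the two smallest exponent values are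
ever «live», and the census is that of a `K = 2` design plus one term per sign.  The `2(K+1)` epochs of the informal picture (conjb-2 g7 memo §2)
live at slopes `0 < |θ| < 1`, which integer slopes never visit; rescaling to reach them (`…TropicalBRationalSlopes`: `v ↦ q·v`) multiplies `R` by
`q` and leaves the sector.  [folklore: exchange bookkeeping; this file]
-/

set_option linter.dupNamespace false
set_option autoImplicit false

namespace Summit.ValiantsHypothesis.ValiantsHypothesis.Theorems.KPlusLogSqLaw

namespace Epoch

open Summit.ValiantsHypothesis.ValiantsHypothesis.Theorems.MatrixDescartes.Negative
open Summit.ValiantsHypothesis.ValiantsHypothesis.Theorems.LacunarySymmetroidMatrixDescartes.TropicalCensus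
open Finset
open scoped BigOperators

variable {m K : ℕ}

/-! ## 1. At integer slopes everything above the least positive value is frozen -/

/-- **Frozen at once.**  With `4mR < ρ` and `ρ`-separated values, a class `l` above a class `l'` of POSITIVE value is frozen at every slope
`θ ≠ 0`: `4mR < |θ|·d l`. [this file] -/
theorem frozen_of_pos_lt (d : Fin K → ℕ) (R ρ : ℕ) (hρR : 4 * m * R < ρ)
    (hsep : ∀ l l' : Fin K, d l < d l' → ρ * d l < d l') {θ : ℤ} (hθ : θ ≠ 0) {l l' : Fin K} (hpos : 0 < d l')
    (hlt : d l' < d l) : 4 * m * R < θ.natAbs * d l := by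
  have ht : 1 ≤ θ.natAbs := Int.natAbs_pos.mpr hθ
  have h1 : ρ ≤ ρ * d l' := Nat.le_mul_of_pos_right _ hpos
  calc 4 * m * R < ρ := hρR
    _ ≤ ρ * d l' := h1
    _ ≤ d l := (hsep l' l hlt).le
    _ ≤ θ.natAbs * d l := Nat.le_mul_of_pos_left _ ht

/-- **Slope split at the least positive value.**  If every positive value is `≥ D₁`, then
`Σᵢ d (r i) = Σ_{D₁ < d (r i)} d (r i) + D₁ · #{i : d (r i) = D₁}` (the columns below `D₁` carry the value `0`). [folklore] -/
theorem sum_d_eq_above_add_of_minPos (d : Fin K → ℕ) (r : Fin m → Fin K) (D₁ : ℕ)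
    (hmin : ∀ l, 0 < d l → D₁ ≤ d l) :
    ∑ i, d (r i) = ∑ i ∈ univ.filter (fun i => D₁ < d (r i)), d (r i) + D₁ * (univ.filter fun i => d (r i) = D₁).card := by
  have hbelow : ∑ i ∈ univ.filter (fun i => d (r i) < D₁), d (r i) = 0 := by
    refine sum_eq_zero fun i hi => ?_
    have hlt := (mem_filter.mp hi).2
    by_contra h0
    exact absurd (hmin (r i) (Nat.pos_of_ne_zero h0)) (not_le.mpr hlt)
  rw [sum_d_split3 d r D₁, hbelow, add_zero]

/-! ## 2. Two frozen sets per sign -/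

/-- **EPOCH COUNT, sharp (one sign).**  `|v| ≤ R`, values `ρ`-separated, `2m ≤ ρ`, `4mR < ρ`; a chain of unique optima at strictly increasing
integer slopes with distinct consecutive terms.  Then the indices `k` with `0 < σ·θ_k` (`σ = ±1`) number at most `m + 2`. [this file] -/
theorem card_sign_le_sharp (d : Fin K → ℕ) (v ε : Fin m → Fin m → Fin K → ℤ) (R ρ : ℕ) (hρm : 2 * m ≤ ρ) (hρR : 4 * m * R < ρ)
    (hv : ∀ i j l, (v i j l).natAbs ≤ R) (hsep : ∀ l l' : Fin K, d l < d l' → ρ * d l < d l')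
    {n : ℕ} (θ : Fin (n + 1) → ℤ) (p : Fin (n + 1) → Equiv.Perm (Fin m) × (Fin m → Fin K))
    (hθ : StrictMono θ) (hdom : ∀ k, IsDominant d v ε (θ k) (p k)) (hne : ∀ k : Fin n, p k.castSucc ≠ p k.succ)
    (σ : ℤ) (hσ : σ = 1 ∨ σ = -1) :
    (univ.filter fun k => 0 < σ * θ k).card ≤ m + 2 := by
  classical
  -- slopes strictly increase along the chain
  have hsm : StrictMono fun k => ∑ i, d ((p k).2 i) := by
    refine Fin.strictMono_iff_lt_succ.mpr fun k => ?_
    exact sum_d_lt_of_dominant d v ε (hθ k.castSucc_lt_succ) (hne k) (hdom _) (hdom _)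
  set I := univ.filter fun k => 0 < σ * θ k with hI
  -- signs and nonvanishing on `I`
  have hsign : ∀ k ∈ I, ∀ k' ∈ I, (0 < θ k ∧ 0 < θ k') ∨ (θ k < 0 ∧ θ k' < 0) := by
    intro k hk k' hk'
    have h1 := (mem_filter.mp hk).2
    have h2 := (mem_filter.mp hk').2
    rcases hσ with rfl | rfl
    · left; constructor <;> linarith
    · right; constructor <;> linarith
  have hnz : ∀ k ∈ I, θ k ≠ 0 := by
    intro k hk h0
    have h1 := (mem_filter.mp hk).2
    rw [h0, mul_zero] at h1
    exact lt_irrefl _ h1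
  -- no positive value at all: all slopes vanish, at most one index
  by_cases hposval : ∃ l : Fin K, 0 < d l
  swap
  · push Not at hposval
    have hS0 : ∀ k, ∑ i, d ((p k).2 i) = 0 := fun k => sum_eq_zero fun i _ => Nat.le_zero.mp (hposval _)
    have hI1 : I.card ≤ 1 := card_le_one.mpr fun a _ b _ => hsm.injective (by simp only [hS0])
    omega
  -- the least positive value `D₁ = d l₁`
  obtain ⟨l₁, hl₁mem, hl₁min⟩ := exists_min_image (univ.filter fun l : Fin K => 0 < d l) d
    (by obtain ⟨l, hl⟩ := hposval; exact ⟨l, mem_filter.mpr ⟨mem_univ _, hl⟩⟩)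
  have hD₁pos : 0 < d l₁ := (mem_filter.mp hl₁mem).2
  have hmin : ∀ l, 0 < d l → d l₁ ≤ d l := fun l hl => hl₁min l (mem_filter.mpr ⟨mem_univ _, hl⟩)
  set D₁ := d l₁ with hD₁
  -- every value above `D₁` is frozen at every index of `I`
  have hfrozen_above : ∀ k ∈ I, ∀ D : ℕ, D₁ < D → (∃ l : Fin K, d l = D) → 4 * m * R < (θ k).natAbs * D := by
    intro k hk D hD ⟨l, hl⟩
    rw [← hl] at hD ⊢
    exact frozen_of_pos_lt d R ρ hρR hsep (hnz k hk) hD₁pos hD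
  -- two indices of `I` agree on every value count above `D₁`
  have hagree : ∀ k ∈ I, ∀ k' ∈ I, ∀ D : ℕ, D₁ < D →
      (univ.filter fun i => d ((p k).2 i) = D).card = (univ.filter fun i => d ((p k').2 i) = D).card := by
    intro k hk k' hk' D hD
    by_contra hneq
    have hval := exists_class_of_countVal_ne d (p k).2 (p k').2 D hneq
    exact hneq (countVal_eq_of_frozen d v ε R ρ hρm hv hsep (hsign k hk k' hk') (hdom k) (hdom k') D
      (hfrozen_above k hk D hD hval) (hfrozen_above k' hk' D hD hval))
  -- split `I` by whether `D₁` itself is frozen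
  set I₂ := I.filter fun k => 4 * m * R < (θ k).natAbs * D₁ with hI₂
  set I₁ := I.filter fun k => ¬ 4 * m * R < (θ k).natAbs * D₁ with hI₁
  have hsplit : I₂.card + I₁.card = I.card := card_filter_add_card_filter_not _
  -- `I₂`: all positive values frozen ⇒ equal slopes ⇒ at most one index
  have hI₂ : I₂.card ≤ 1 := by
    refine card_le_one.mpr fun a ha b hb => ?_
    have haI : a ∈ I := (mem_filter.mp ha).1
    have hbI : b ∈ I := (mem_filter.mp hb).1
    apply hsm.injective
    show ∑ i, d ((p a).2 i) = ∑ i, d ((p b).2 i)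
    have hcnt : ∀ D : ℕ, 0 < D →
        (univ.filter fun i => d ((p a).2 i) = D).card = (univ.filter fun i => d ((p b).2 i) = D).card := by
      intro D hD
      rcases (show D₁ < D ∨ D = D₁ ∨ D < D₁ by omega) with h | h | h
      · exact hagree a haI b hbI D h
      · rw [h]
        by_contra hneq
        exact hneq (countVal_eq_of_frozen d v ε R ρ hρm hv hsep (hsign a haI b hbI) (hdom a) (hdom b) D₁
          (mem_filter.mp ha).2 (mem_filter.mp hb).2)
      · -- no class has a positive value below `D₁`: both counts vanish
        by_contra hneq
        obtain ⟨l, hl⟩ := exists_class_of_countVal_ne d (p a).2 (p b).2 D hneq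
        have := hmin l (by rw [hl]; exact hD)
        rw [hl] at this
        exact absurd h (not_lt.mpr this)
    have ha' := sum_above_eq_of_countVal d (p a).2 (p b).2 0 (fun D hD => hcnt D hD)
    have hz : ∀ r : Fin m → Fin K, ∑ i, d (r i) = ∑ i ∈ univ.filter (fun i => 0 < d (r i)), d (r i) := by
      intro r
      rw [← sum_filter_add_sum_filter_not univ (fun i => 0 < d (r i))]
      have h0 : ∑ i ∈ univ.filter (fun i => ¬ 0 < d (r i)), d (r i) = 0 :=
        sum_eq_zero fun i hi => by have := (mem_filter.mp hi).2; omega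
      rw [h0, add_zero]
    rw [hz (p a).2, hz (p b).2, ha']
  -- `I₁`: slopes are `A + D₁·#{d = D₁}` with a common `A` ⇒ inject into `range (m+1)` by the `D₁`-count
  have hI₁ : I₁.card ≤ m + 1 := by
    have hmaps : ∀ k ∈ I₁, (univ.filter fun i => d ((p k).2 i) = D₁).card ∈ range (m + 1) := by
      intro k _
      rw [mem_range]
      exact Nat.lt_succ_of_le ((card_le_univ _).trans (by rw [Fintype.card_fin]))
    have hinj : Set.InjOn (fun k => (univ.filter fun i => d ((p k).2 i) = D₁).card) ↑I₁ := by
      intro a ha b hb hab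
      rw [coe_filter, Set.mem_setOf_eq] at ha hb
      have haI : a ∈ I := ha.1
      have hbI : b ∈ I := hb.1
      apply hsm.injective
      show ∑ i, d ((p a).2 i) = ∑ i, d ((p b).2 i)
      rw [sum_d_eq_above_add_of_minPos d (p a).2 D₁ hmin, sum_d_eq_above_add_of_minPos d (p b).2 D₁ hmin,
        sum_above_eq_of_countVal d (p a).2 (p b).2 D₁ (fun D hD => hagree a haI b hbI D hD)]
      simp only at hab
      rw [hab]
    calc I₁.card ≤ (range (m + 1)).card := card_le_card_of_injOn _ hmaps hinj
      _ = m + 1 := card_range _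
  omega

/-! ## 3. The `K`-free law -/

/-- **THE `K`-FREE EPOCH LAW.**  In a dominance design of format `(m, K)` with valuations `|v| ≤ R` and exponent values `ρ`-separated
(`d l < d l' → ρ·d l < d l'`) for some `ρ ≥ 2m` with `ρ > 4mR`, every chain of unique optima at strictly increasing integer slopes with distinct
consecutive terms has `n + 1 ≤ 2m + 5` terms, whatever `K` is. [this file] -/
theorem chain_le_sharp (d : Fin K → ℕ) (v ε : Fin m → Fin m → Fin K → ℤ) (R ρ : ℕ) (hρm : 2 * m ≤ ρ) (hρR : 4 * m * R < ρ)
    (hv : ∀ i j l, (v i j l).natAbs ≤ R) (hsep : ∀ l l' : Fin K, d l < d l' → ρ * d l < d l')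
    {n : ℕ} (θ : Fin (n + 1) → ℤ) (p : Fin (n + 1) → Equiv.Perm (Fin m) × (Fin m → Fin K))
    (hθ : StrictMono θ) (hdom : ∀ k, IsDominant d v ε (θ k) (p k)) (hne : ∀ k : Fin n, p k.castSucc ≠ p k.succ) :
    n + 1 ≤ 2 * m + 5 := by
  classical
  have hpos := card_sign_le_sharp d v ε R ρ hρm hρR hv hsep θ p hθ hdom hne 1 (Or.inl rfl)
  have hneg := card_sign_le_sharp d v ε R ρ hρm hρR hv hsep θ p hθ hdom hne (-1) (Or.inr rfl)
  have hzero : (univ.filter fun k => θ k = 0).card ≤ 1 := by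
    refine card_le_one.mpr fun a ha b hb => hθ.injective ?_
    rw [(mem_filter.mp ha).2, (mem_filter.mp hb).2]
  have hcover : (univ : Finset (Fin (n + 1))) ⊆
      ((univ.filter fun k => 0 < (1 : ℤ) * θ k) ∪ (univ.filter fun k => 0 < (-1 : ℤ) * θ k)) ∪
        (univ.filter fun k => θ k = 0) := by
    intro k _
    rcases lt_trichotomy (θ k) 0 with h | h | h
    · exact mem_union_left _ (mem_union_right _ (mem_filter.mpr ⟨mem_univ _, by linarith⟩))
    · exact mem_union_right _ (mem_filter.mpr ⟨mem_univ _, h⟩)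
    · exact mem_union_left _ (mem_union_left _ (mem_filter.mpr ⟨mem_univ _, by linarith⟩))
  calc n + 1 = (univ : Finset (Fin (n + 1))).card := by rw [card_univ, Fintype.card_fin]
    _ ≤ (((univ.filter fun k => 0 < (1 : ℤ) * θ k) ∪ (univ.filter fun k => 0 < (-1 : ℤ) * θ k)) ∪
          (univ.filter fun k => θ k = 0)).card := card_le_card hcover
    _ ≤ ((univ.filter fun k => 0 < (1 : ℤ) * θ k).card + (univ.filter fun k => 0 < (-1 : ℤ) * θ k).card) +
          (univ.filter fun k => θ k = 0).card :=
        (card_union_le _ _).trans (Nat.add_le_add_right (card_union_le _ _) _)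
    _ ≤ ((m + 2) + (m + 2)) + 1 := Nat.add_le_add (Nat.add_le_add hpos hneg) hzero
    _ = 2 * m + 5 := by ring

/-- **`EpochLaw`, sharpened to a `K`-free bound.**  The typed hypotheses of `Epoch.epochLaw` (valuations bounded by `R`, distinct exponent values
separated by `16(m+1)²(R+1)`, signs in `{−1,0,1}`, a dominant sign-alternating chain at strictly increasing integer slopes) give `n + 1 ≤ 2m + 5`.
[this file] -/
theorem epochLaw_sharp :
    ∀ (m K R : ℕ) (d : Fin K → ℕ) (v ε : Fin m → Fin m → Fin K → ℤ) (n : ℕ) (θ : Fin (n + 1) → ℤ)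
      (p : Fin (n + 1) → Equiv.Perm (Fin m) × (Fin m → Fin K)),
      (∀ i j l, (v i j l).natAbs ≤ R) →
      (∀ l l', d l < d l' → 16 * (m + 1) ^ 2 * (R + 1) * d l < d l') →
      (∀ i j l, (ε i j l).natAbs ≤ 1) → StrictMono θ → (∀ k, IsDominant d v ε (θ k) (p k)) →
      (∀ k : Fin n, termSign ε (p k.castSucc) * termSign ε (p k.succ) < 0) →
      n + 1 ≤ 2 * m + 5 := by
  intro m K R d v ε n θ p hv hsep _hε hθ hdom halt
  have hne : ∀ k : Fin n, p k.castSucc ≠ p k.succ := by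
    intro k h
    have := halt k
    rw [h] at this
    exact absurd this (not_lt.mpr (mul_self_nonneg _))
  have hρm : 2 * m ≤ 16 * (m + 1) ^ 2 * (R + 1) := by nlinarith
  have hρR : 4 * m * R < 16 * (m + 1) ^ 2 * (R + 1) := by nlinarith
  exact chain_le_sharp d v ε R (16 * (m + 1) ^ 2 * (R + 1)) hρm hρR hv hsep θ p hθ hdom hne

end Epoch

end Summit.ValiantsHypothesis.ValiantsHypothesis.Theorems.KPlusLogSqLaw
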